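import Summits.SmoothPoincare4.SmoothPoincare4.Theorems.ShadowsStandard.Negative.ShadowLevels

/-!
# Negative lemmas for the crux `ShadowsStandard` (item stmt-SmoothPoincare4-14593), II: the `Hom(S,Q)` criterion and the level gate

Refuter lemmas (cdisprove seat, cycle 2) for the crux
`Summit.SmoothPoincare4.SmoothPoincare4.Theses.CongruenceShadows.ShadowsStandard`. Nothing here asserts
the crux. Continuation of `ShadowLevels.lean` (levels `M_Q = levelSubgroup g Q = ⋂ ker (S_g →* Q)`,
`ShadowStandardAt`).

## Content

* §1 `exists_section_of_free`: a normal subgroup with free quotient is split (a hom section of the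
  quotient map).
* §2 `sup_levelSubgroup_eq_iInf_ker`: for `P ⊴ S_g` with `S_g ⧸ P` free (every handlebody kernel, every
  pair product of a group trisection), `P ⊔ M_Q = ⋂ {ker φ | φ : S_g →* Q, φ(P) = 1}` — the level-`Q`
  shadow of `P` is determined by the finite set `E_Q(P) = {φ | φ(P) = 1} ⊆ Hom(S_g, Q)`.
* §3 `shadowStandardAt_level_iff`: COMPLETENESS of the `Hom(S,Q)` invariant — the shadow of `K` at level
  `M_Q` is standard iff some automorphism `ψ` of `S_g` transports the three killer sets,
  `K_i ≤ ker φ ↔ N_i ≤ ker (φ ∘ ψ)` for all `φ : S_g →* Q` (cycle 1 had only "standard ⇒ equal counts").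
  So level-`Q` standardness is a property of an orbit of the IMAGE of `Aut S_g` in the finite symmetric
  group `Sym(Hom(S_g,Q))` — decidable per `(g, Q)`, which is what the seat's GAP computation decides.
* §4 `ShadowStandardAt.comp_iso` / `iso_invariant` (invariance under isomorphism of triples),
  `eq_one_of_le_ker` (the level triple condition of a trisection of `{1}`), `levelGate_standard`:
  the K-FREE LEVEL GATE at a level `M` — if every pair `a, b` of automorphisms with `a(N₀) = N₀`,
  `b(N₁) = N₁`, `a(N₂) ⊔ M = b(N₂) ⊔ M` and the triple condition (every hom to the test group `T`
  killing `N₀, N₁, a(N₂)` is trivial) admits `y` fixing `N₀ ⊔ M`, `N₁ ⊔ M` with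
  `y(N₂ ⊔ M) = a(N₂) ⊔ M`, then every group trisection of `{1}` with `K₀ = N₀`, `K₁ = N₁` and standard
  pairs has standard shadow at `M`.
* §5 `isGroupTrisection_map_equiv` (AGK's notion is invariant under `Aut S_g`), `pair_transport`,
  `shadowStandardAt_of_levelGate`: the gate at a characteristic `M` gives standard level-`M` shadows for
  EVERY group trisection of `{1}` with standard pairs (the conclusion of the route item
  `WaldhausenPairs`), by normalising `(K₀, K₁)` to `(N₀, N₁)`. The seat verified the gate hypothesis by
  computer at `m = 0`, `M = M_Q` for small `Q` (GAP, kit jobs; see the crux work file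
  `Cruxes/ShadowsStandard/Disproof.lean` §7): at those levels NO genus-3 counterexample to the crux exists.

Sources: Abrams–Gay–Kirby 2018 (arXiv:1605.06731) §1–2 (group trisections, handlebody kernels have free
quotients); the splitting of a surjection onto a free group is folklore.
-/

noncomputable section

namespace Summit.SmoothPoincare4.SmoothPoincare4.Theorems.ShadowsStandard.Negative

open Literature.Topology.FourManifolds Subgroup
open Summit.SmoothPoincare4.SmoothPoincare4.Theses.CongruenceShadows (ShadowsStandard)

/-! ## §1 Free quotients split -/

/-- A surjection onto a free group splits: if `G ⧸ P ≅ F(ι)` then the quotient map has a hom section.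
[folklore] -/
theorem exists_section_of_free {G : Type*} [Group G] (P : Subgroup G) [P.Normal] {ι : Type*}
    (e : FreeGroup ι ≃* G ⧸ P) :
    ∃ s : G ⧸ P →* G, (QuotientGroup.mk' P).comp s = MonoidHom.id _ := by
  choose f hf using fun i : ι => QuotientGroup.mk_surjective (e (FreeGroup.of i))
  refine ⟨(FreeGroup.lift f).comp e.symm.toMonoidHom, ?_⟩
  have key : (QuotientGroup.mk' P).comp (FreeGroup.lift f) = e.toMonoidHom := by
    ext i
    simp [hf]
  apply MonoidHom.ext
  intro q
  obtain ⟨w, rfl⟩ := e.surjective q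
  have := DFunLike.congr_fun key w
  simpa using this

/-! ## §2 The level shadow of a handlebody kernel is cut out by its killers -/

/-- **Killer description of level shadows.** For `P ⊴ S_g` with free quotient and any group `Q`,
`P ⊔ M_Q = ⋂ {ker φ | φ : S_g →* Q, P ≤ ker φ}`. (`≤` is formal; for `≥`, split `S_g ↠ S_g ⧸ P` by
`s` and write `x = (x · s(x̄)⁻¹) · s(x̄)` with the first factor in `P` and the second in `M_Q`, because
`ψ ∘ s ∘ π` kills `P` for every `ψ : S_g →* Q`.) [folklore] -/
theorem sup_levelSubgroup_eq_iInf_ker {g : ℕ} (P : Subgroup (SurfaceGroup g)) [P.Normal] {n : ℕ}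
    (hP : IsFreeOfRank (SurfaceGroup g ⧸ P) n) (Q : Type*) [Group Q] :
    P ⊔ levelSubgroup g Q =
      ⨅ φ : {φ : SurfaceGroup g →* Q // P ≤ φ.ker}, (φ : SurfaceGroup g →* Q).ker := by
  apply le_antisymm
  · refine sup_le (le_iInf fun φ => φ.2) (le_iInf fun φ => levelSubgroup_le_ker _)
  · intro x hx
    obtain ⟨e⟩ := hP
    obtain ⟨s, hs⟩ := exists_section_of_free P e
    rw [mem_iInf] at hx
    set q : SurfaceGroup g ⧸ P := (x : SurfaceGroup g ⧸ P) with hq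
    have hsq : (s q : SurfaceGroup g ⧸ P) = q := by
      have := DFunLike.congr_fun hs q
      simpa using this
    have h1 : x * (s q)⁻¹ ∈ P := by
      rw [← QuotientGroup.eq_one_iff, QuotientGroup.mk_mul, QuotientGroup.mk_inv, hsq, mul_inv_cancel]
    have h2 : s q ∈ levelSubgroup g Q := by
      refine mem_iInf.2 fun ψ => ?_
      rw [MonoidHom.mem_ker]
      have hφ : P ≤ ((ψ.comp s).comp (QuotientGroup.mk' P)).ker := by
        intro p hp
        have hp' : QuotientGroup.mk' P p = 1 := by
          rw [QuotientGroup.mk'_apply, QuotientGroup.eq_one_iff]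
          exact hp
        rw [MonoidHom.mem_ker, MonoidHom.comp_apply, MonoidHom.comp_apply, hp', map_one, map_one]
      have := hx ⟨_, hφ⟩
      rw [MonoidHom.mem_ker, MonoidHom.comp_apply, MonoidHom.comp_apply, QuotientGroup.mk'_apply] at this
      exact this
    have hx' : x = (x * (s q)⁻¹) * s q := by group
    rw [hx']
    exact mul_mem (mem_sup_left h1) (mem_sup_right h2)

/-- Membership form of §2: `x ∈ P ⊔ M_Q ↔ every φ : S_g →* Q killing P kills x`. [folklore] -/
theorem mem_sup_levelSubgroup_iff {g : ℕ} (P : Subgroup (SurfaceGroup g)) [P.Normal] {n : ℕ}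
    (hP : IsFreeOfRank (SurfaceGroup g ⧸ P) n) (Q : Type*) [Group Q] (x : SurfaceGroup g) :
    x ∈ P ⊔ levelSubgroup g Q ↔ ∀ φ : SurfaceGroup g →* Q, P ≤ φ.ker → φ x = 1 := by
  rw [sup_levelSubgroup_eq_iInf_ker P hP Q, mem_iInf]
  constructor
  · intro h φ hφ
    exact h ⟨φ, hφ⟩
  · intro h φ
    exact h φ.1 φ.2

/-! ## §3 Completeness of the `Hom(S,Q)` invariant -/

/-- The kernels of a group trisection have free quotients (the `free_quotient` field, transported from
the normal closure to the kernel itself). [cite: AbramsGayKirby2018, Def. 1] -/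
theorem isFreeOfRank_quotient_of_isGroupTrisection {g k : ℕ} {G : Type*} [Group G]
    {K : TrisectionKernels g} (hK : IsGroupTrisection g k G K) (i : Fin 3) [(K i).Normal] :
    IsFreeOfRank (SurfaceGroup g ⧸ K i) g :=
  (hK.free_quotient i).of_mulEquiv (QuotientGroup.quotientMulEquivOfEq (normalClosure_eq_self _))

/-- The standard kernels are normal. [folklore] -/
instance normal_N (m : ℕ) (i : Fin 3) : (N m i).Normal :=
  (stabilizeIter_isGroupTrisection m).normal i

/-- The standard kernels have free quotients of rank `3 + 3m`. [folklore] -/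
theorem isFreeOfRank_quotient_N (m : ℕ) (i : Fin 3) :
    IsFreeOfRank (SurfaceGroup (3 + 3 * m) ⧸ N m i) (3 + 3 * m) :=
  isFreeOfRank_quotient_of_isGroupTrisection (stabilizeIter_isGroupTrisection m) i

/-- `M_Q ≤ ker φ` in `sup` form. [folklore] -/
theorem sup_levelSubgroup_le_ker_iff {g : ℕ} (P : Subgroup (SurfaceGroup g)) {Q : Type*} [Group Q]
    (φ : SurfaceGroup g →* Q) : P ⊔ levelSubgroup g Q ≤ φ.ker ↔ P ≤ φ.ker := by
  rw [sup_le_iff]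
  exact ⟨fun h => h.1, fun h => ⟨h, levelSubgroup_le_ker φ⟩⟩

/-- **The `Hom(S,Q)` criterion (both directions).** For a kernel triple `K` with normal kernels and
free quotients (e.g. any group trisection), the shadow of `K` at the level `M_Q` is standard iff some
automorphism `ψ` of `S_g` transports the killer sets: `K_i ≤ ker φ ↔ N_i ≤ ker (φ ∘ ψ)` for all
`φ : S_g →* Q` and all `i`. The forward direction needs no freeness. [folklore] -/
theorem shadowStandardAt_level_iff {m : ℕ} {K : TrisectionKernels (3 + 3 * m)}
    [hn : ∀ i, (K i).Normal]
    (hf : ∀ i, IsFreeOfRank (SurfaceGroup (3 + 3 * m) ⧸ K i) (3 + 3 * m))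
    (Q : Type*) [Group Q] :
    ShadowStandardAt m K (levelSubgroup _ Q) ↔
      ∃ ψ : SurfaceGroup (3 + 3 * m) ≃* SurfaceGroup (3 + 3 * m),
        ∀ (i : Fin 3) (φ : SurfaceGroup (3 + 3 * m) →* Q),
          K i ≤ φ.ker ↔ N m i ≤ (φ.comp ψ.toMonoidHom).ker := by
  constructor
  · rintro ⟨ψ, hψ⟩
    refine ⟨ψ, fun i φ => ?_⟩
    rw [← sup_levelSubgroup_le_ker_iff (K i) φ, ← hψ i, map_le_iff_le_comap, MonoidHom.comap_ker,
      sup_levelSubgroup_le_ker_iff]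
  · rintro ⟨ψ, hψ⟩
    refine ⟨ψ, fun i => ?_⟩
    ext x
    rw [mem_map_equiv, mem_sup_levelSubgroup_iff (N m i) (isFreeOfRank_quotient_N m i) Q,
      mem_sup_levelSubgroup_iff (K i) (hf i) Q]
    constructor
    · intro h φ hφ
      have h' := h (φ.comp ψ.toMonoidHom) ((hψ i φ).1 hφ)
      simpa using h'
    · intro h φ hφ
      have hK : K i ≤ (φ.comp ψ.symm.toMonoidHom).ker := by
        rw [hψ i]
        intro y hy
        simpa using hφ hy
      have h' := h _ hK
      simpa using h'

/-- The criterion for group trisections of any group `G`. [folklore] -/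
theorem shadowStandardAt_level_iff_of_isGroupTrisection {m k : ℕ} {G : Type*} [Group G]
    {K : TrisectionKernels (3 + 3 * m)} (hK : IsGroupTrisection (3 + 3 * m) k G K)
    (Q : Type*) [Group Q] :
    ShadowStandardAt m K (levelSubgroup _ Q) ↔
      ∃ ψ : SurfaceGroup (3 + 3 * m) ≃* SurfaceGroup (3 + 3 * m),
        ∀ (i : Fin 3) (φ : SurfaceGroup (3 + 3 * m) →* Q),
          K i ≤ φ.ker ↔ N m i ≤ (φ.comp ψ.toMonoidHom).ker := by
  haveI : ∀ i, (K i).Normal := hK.normal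
  exact shadowStandardAt_level_iff (fun i => isFreeOfRank_quotient_of_isGroupTrisection hK i) Q

/-! ## §4 Invariance, pair normal form, and the level gate -/

/-- Shadow standardness is invariant under isomorphism of the triple (left composition). [folklore] -/
theorem ShadowStandardAt.comp_iso {m : ℕ} {K K' : TrisectionKernels (3 + 3 * m)}
    {M : Subgroup (SurfaceGroup (3 + 3 * m))} (hM : M.Characteristic)
    (h : ShadowStandardAt m K M) (hKK' : TrisectionKernels.Iso K K') : ShadowStandardAt m K' M := by
  obtain ⟨ψ, hψ⟩ := h
  obtain ⟨α, hα⟩ := hKK'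
  refine ⟨ψ.trans α, fun i => ?_⟩
  have : (ψ.trans α).toMonoidHom = α.toMonoidHom.comp ψ.toMonoidHom := rfl
  rw [this, ← Subgroup.map_map, hψ i, Subgroup.map_sup, hα i, (characteristic_iff_map_eq.1 hM) α]

/-- Isomorphism of triples is symmetric. [folklore] -/
theorem _root_.Literature.Topology.FourManifolds.TrisectionKernels.Iso.symm' {g : ℕ}
    {K K' : TrisectionKernels g} (h : TrisectionKernels.Iso K K') : TrisectionKernels.Iso K' K := by
  obtain ⟨α, hα⟩ := h
  refine ⟨α.symm, fun i => ?_⟩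
  rw [← hα i, Subgroup.map_map]
  have : α.symm.toMonoidHom.comp α.toMonoidHom = MonoidHom.id _ := by
    ext x; simp
  rw [this, Subgroup.map_id]

/-- Shadow standardness at a characteristic level is a property of the isomorphism class. [folklore] -/
theorem ShadowStandardAt.iso_invariant {m : ℕ} {K K' : TrisectionKernels (3 + 3 * m)}
    {M : Subgroup (SurfaceGroup (3 + 3 * m))} (hM : M.Characteristic)
    (hKK' : TrisectionKernels.Iso K K') : ShadowStandardAt m K M ↔ ShadowStandardAt m K' M :=
  ⟨fun h => h.comp_iso hM hKK', fun h => h.comp_iso hM hKK'.symm'⟩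

/-- The level triple condition of a group trisection of the trivial group: a homomorphism killing all
three kernels is trivial. [cite: AbramsGayKirby2018, Def. 1] -/
theorem eq_one_of_le_ker {g k : ℕ} {K : TrisectionKernels g}
    (hK : IsGroupTrisection g k (PUnit : Type) K) {Q : Type*} [Group Q] (φ : SurfaceGroup g →* Q)
    (hφ : ∀ i, K i ≤ φ.ker) : φ = 1 := by
  obtain ⟨e⟩ := hK.triple
  have hle : normalClosure (⋃ i, (K i : Set (SurfaceGroup g))) ≤ φ.ker := by
    refine normalClosure_le_normal ?_
    intro x hx
    obtain ⟨i, hi⟩ := Set.mem_iUnion.1 hx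
    exact hφ i hi
  refine MonoidHom.ext fun x => ?_
  have hx : (QuotientGroup.mk x : K.tripleQuotient) = 1 := by
    apply e.injective
    exact Subsingleton.elim _ _
  rw [QuotientGroup.eq_one_iff] at hx
  rw [MonoidHom.one_apply]
  exact (MonoidHom.mem_ker).1 (hle hx)

/-- **The level gate (K-free) implies level standardness of every pair-normalised triple.**
Fix `m`, a characteristic level `M` and suppose: for all automorphisms `a, b` of `S` with `a(N₀) = N₀`,
`b(N₁) = N₁`, `a(N₂) ⊔ M = b(N₂) ⊔ M`, and such that every `φ : S →* S ⧸ M`… — we use the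
intrinsic triple condition "every hom to ANY group killing `N₀, N₁, a(N₂)` is trivial" restricted to the
single test group `T` — there is `y` with `y(N₀ ⊔ M) = N₀ ⊔ M`, `y(N₁ ⊔ M) = N₁ ⊔ M`,
`y(N₂ ⊔ M) = a(N₂) ⊔ M`. Then every group trisection `K` of `{1}` whose pairs `(K₀,K₂)`, `(K₁,K₂)` are
standard and with `K₀ = N₀`, `K₁ = N₁` has standard shadow at `M`. (With `WaldhausenPairs` and
`iso_invariant` this covers every group trisection of `{1}`; the seat's computation verifies the
hypothesis at `m = 0`, `M = M_Q` for small `Q`, with `T = Q`.) [folklore] -/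
theorem levelGate_standard {m : ℕ} (M : Subgroup (SurfaceGroup (3 + 3 * m)))
    (T : Type*) [Group T]
    (gate : ∀ a b : SurfaceGroup (3 + 3 * m) ≃* SurfaceGroup (3 + 3 * m),
      (N m 0).map a.toMonoidHom = N m 0 → (N m 1).map b.toMonoidHom = N m 1 →
      (N m 2).map a.toMonoidHom ⊔ M = (N m 2).map b.toMonoidHom ⊔ M →
      (∀ φ : SurfaceGroup (3 + 3 * m) →* T, N m 0 ≤ φ.ker → N m 1 ≤ φ.ker →
        (N m 2).map a.toMonoidHom ≤ φ.ker → φ = 1) →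
      ∃ y : SurfaceGroup (3 + 3 * m) ≃* SurfaceGroup (3 + 3 * m),
        (N m 0 ⊔ M).map y.toMonoidHom = N m 0 ⊔ M ∧ (N m 1 ⊔ M).map y.toMonoidHom = N m 1 ⊔ M ∧
        (N m 2 ⊔ M).map y.toMonoidHom = (N m 2).map a.toMonoidHom ⊔ M)
    {k : ℕ} (K : TrisectionKernels (3 + 3 * m)) (hK : IsGroupTrisection (3 + 3 * m) k (PUnit : Type) K)
    (h0 : K 0 = N m 0) (h1 : K 1 = N m 1)
    (h02 : ∃ a : SurfaceGroup (3 + 3 * m) ≃* SurfaceGroup (3 + 3 * m),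
      (N m 0).map a.toMonoidHom = K 0 ∧ (N m 2).map a.toMonoidHom = K 2)
    (h12 : ∃ b : SurfaceGroup (3 + 3 * m) ≃* SurfaceGroup (3 + 3 * m),
      (N m 1).map b.toMonoidHom = K 1 ∧ (N m 2).map b.toMonoidHom = K 2) :
    ShadowStandardAt m K M := by
  obtain ⟨a, ha0, ha2⟩ := h02
  obtain ⟨b, hb1, hb2⟩ := h12
  have htriple : ∀ φ : SurfaceGroup (3 + 3 * m) →* T, N m 0 ≤ φ.ker → N m 1 ≤ φ.ker →
      (N m 2).map a.toMonoidHom ≤ φ.ker → φ = 1 := by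
    intro φ hφ0 hφ1 hφ2
    refine eq_one_of_le_ker hK φ fun i => ?_
    fin_cases i
    · simpa [h0] using hφ0
    · simpa [h1] using hφ1
    · show K 2 ≤ φ.ker
      rw [← ha2]
      exact hφ2
  obtain ⟨y, hy0, hy1, hy2⟩ := gate a b (by rw [ha0, h0]) (by rw [hb1, h1]) (by rw [ha2, hb2]) htriple
  refine ⟨y, fun i => ?_⟩
  fin_cases i
  · simpa [h0] using hy0
  · simpa [h1] using hy1
  · show (N m 2 ⊔ M).map y.toMonoidHom = K 2 ⊔ M
    rw [← ha2]
    exact hy2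

/-! ## §5 Automorphism invariance of `IsGroupTrisection` and the pair normal form -/

/-- **`IsGroupTrisection` is invariant under automorphisms of the surface group** (the image triple
`i ↦ α(Kᵢ)` is a group trisection of the same type and group). [cite: AbramsGayKirby2018, §2] -/
theorem isGroupTrisection_map_equiv {g k : ℕ} {G : Type*} [Group G] {K : TrisectionKernels g}
    (hK : IsGroupTrisection g k G K) (α : SurfaceGroup g ≃* SurfaceGroup g) :
    IsGroupTrisection g k G (fun i => (K i).map α.toMonoidHom) where
  normal i := by
    haveI := hK.normal i
    exact Subgroup.Normal.map inferInstance _ α.surjective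
  free_quotient i := by
    have he : (normalClosure (K i : Set (SurfaceGroup g))).map α.toMonoidHom
        = normalClosure (((K i).map α.toMonoidHom : Subgroup (SurfaceGroup g)) : Set (SurfaceGroup g)) := by
      rw [Subgroup.map_normalClosure _ _ α.surjective, Subgroup.coe_map]
    exact (hK.free_quotient i).of_mulEquiv (QuotientGroup.congr _ _ α he)
  free_pairQuotient i j hij := by
    have he : (normalClosure ((K i : Set (SurfaceGroup g)) ∪ K j)).map α.toMonoidHom
        = normalClosure ((((K i).map α.toMonoidHom : Subgroup (SurfaceGroup g)) : Set (SurfaceGroup g))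
          ∪ ((K j).map α.toMonoidHom : Subgroup (SurfaceGroup g))) := by
      rw [Subgroup.map_normalClosure _ _ α.surjective, Set.image_union, Subgroup.coe_map, Subgroup.coe_map]
    exact (hK.free_pairQuotient i j hij).of_mulEquiv (QuotientGroup.congr _ _ α he)
  triple := by
    obtain ⟨e⟩ := hK.triple
    have he : (normalClosure (⋃ i, (K i : Set (SurfaceGroup g)))).map α.toMonoidHom
        = normalClosure (⋃ i, (((K i).map α.toMonoidHom : Subgroup (SurfaceGroup g)) : Set (SurfaceGroup g))) := by
      rw [Subgroup.map_normalClosure _ _ α.surjective, Set.image_iUnion]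
      simp only [Subgroup.coe_map]
    exact ⟨(QuotientGroup.congr _ _ α he).symm.trans e⟩

/-- Transporting a standard pair along an automorphism. [folklore] -/
theorem pair_transport {m : ℕ} {K : TrisectionKernels (3 + 3 * m)} {i j : Fin 3}
    (β : SurfaceGroup (3 + 3 * m) ≃* SurfaceGroup (3 + 3 * m))
    (h : ∃ α : SurfaceGroup (3 + 3 * m) ≃* SurfaceGroup (3 + 3 * m),
      (N m i).map α.toMonoidHom = K i ∧ (N m j).map α.toMonoidHom = K j) :
    ∃ α : SurfaceGroup (3 + 3 * m) ≃* SurfaceGroup (3 + 3 * m),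
      (N m i).map α.toMonoidHom = (K i).map β.toMonoidHom ∧
      (N m j).map α.toMonoidHom = (K j).map β.toMonoidHom := by
  obtain ⟨α, hi, hj⟩ := h
  refine ⟨α.trans β, ?_, ?_⟩
  · change (N m i).map (β.toMonoidHom.comp α.toMonoidHom) = _
    rw [← Subgroup.map_map, hi]
  · change (N m j).map (β.toMonoidHom.comp α.toMonoidHom) = _
    rw [← Subgroup.map_map, hj]

/-- **Level standardness from the level gate, for every group trisection of `{1}` with standard
pairs.** Normalise the pair `(K₀, K₁)` to `(N₀, N₁)` by the automorphism `α₀₁` of the standard-pairs hypothesis,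
apply `levelGate_standard` to the normalised triple (a group trisection by
`isGroupTrisection_map_equiv`), and transport back (`iso_invariant`). With `T` any test group for the
triple condition (e.g. `T = S ⧸ M`, or `T = Q` at `M = M_Q`). [folklore] -/
theorem shadowStandardAt_of_levelGate {m : ℕ} (M : Subgroup (SurfaceGroup (3 + 3 * m)))
    (hM : M.Characteristic) (T : Type*) [Group T]
    (gate : ∀ a b : SurfaceGroup (3 + 3 * m) ≃* SurfaceGroup (3 + 3 * m),
      (N m 0).map a.toMonoidHom = N m 0 → (N m 1).map b.toMonoidHom = N m 1 →
      (N m 2).map a.toMonoidHom ⊔ M = (N m 2).map b.toMonoidHom ⊔ M →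
      (∀ φ : SurfaceGroup (3 + 3 * m) →* T, N m 0 ≤ φ.ker → N m 1 ≤ φ.ker →
        (N m 2).map a.toMonoidHom ≤ φ.ker → φ = 1) →
      ∃ y : SurfaceGroup (3 + 3 * m) ≃* SurfaceGroup (3 + 3 * m),
        (N m 0 ⊔ M).map y.toMonoidHom = N m 0 ⊔ M ∧ (N m 1 ⊔ M).map y.toMonoidHom = N m 1 ⊔ M ∧
        (N m 2 ⊔ M).map y.toMonoidHom = (N m 2).map a.toMonoidHom ⊔ M)
    {k : ℕ} (K : TrisectionKernels (3 + 3 * m)) (hK : IsGroupTrisection (3 + 3 * m) k (PUnit : Type) K)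
    (hP : ∀ i j : Fin 3, i ≠ j → ∃ α : SurfaceGroup (3 + 3 * m) ≃* SurfaceGroup (3 + 3 * m),
      (N m i).map α.toMonoidHom = K i ∧ (N m j).map α.toMonoidHom = K j) :
    ShadowStandardAt m K M := by
  obtain ⟨α, hα0, hα1⟩ := hP 0 1 (by decide)
  -- the normalised triple K' = α⁻¹(K)
  set K' : TrisectionKernels (3 + 3 * m) := fun i => (K i).map α.symm.toMonoidHom with hK'
  have hback : ∀ i, (K' i).map α.toMonoidHom = K i := by
    intro i
    simp only [hK', Subgroup.map_map]
    have : α.toMonoidHom.comp α.symm.toMonoidHom = MonoidHom.id _ := by ext x; simp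
    rw [this, Subgroup.map_id]
  have hiso : TrisectionKernels.Iso K' K := ⟨α, hback⟩
  have hK'0 : K' 0 = N m 0 := by
    simp only [hK', ← hα0, Subgroup.map_map]
    have : α.symm.toMonoidHom.comp α.toMonoidHom = MonoidHom.id _ := by ext x; simp
    rw [this, Subgroup.map_id]
  have hK'1 : K' 1 = N m 1 := by
    simp only [hK', ← hα1, Subgroup.map_map]
    have : α.symm.toMonoidHom.comp α.toMonoidHom = MonoidHom.id _ := by ext x; simp
    rw [this, Subgroup.map_id]
  have hK'tris : IsGroupTrisection (3 + 3 * m) k (PUnit : Type) K' := isGroupTrisection_map_equiv hK α.symm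
  have h02 := pair_transport (K := K) (i := 0) (j := 2) α.symm (hP 0 2 (by decide))
  have h12 := pair_transport (K := K) (i := 1) (j := 2) α.symm (hP 1 2 (by decide))
  have hstd : ShadowStandardAt m K' M := levelGate_standard M T gate K' hK'tris hK'0 hK'1 h02 h12
  exact (ShadowStandardAt.iso_invariant hM hiso).1 hstd

end Summit.SmoothPoincare4.SmoothPoincare4.Theorems.ShadowsStandard.Negative

end
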